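import Summits.AtomisticToContinuum.Crystallization.Theorems.ReggeStarCoercivityDefectFreeCrystallizesPalmDefs
import Summits.AtomisticToContinuum.Crystallization.Theorems.LayeredLawsSelectHcp.Negative.DiracLaws
import Summits.AtomisticToContinuum.Crystallization.Theorems.PalmUnimodularRigidityShellsToBarlowChartCubicGrowthAngle
import Summits.AtomisticToContinuum.Crystallization.Theorems.ReggeStarCoercivityDefectFreeCrystallizesGoodOfSmallStarDefect
import Literature.Geometry.DiscreteGeometry.KissingPatterns
import HarnessLib

/-!
# The `1 %`-tube class sits inside the `1/20`-funnel class (stub `stub_funnelOfLayered` of line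
# `palm-good-law`, crux `ReggeStarCoercivity.DefectFreeCrystallizes`, stmt-AtomisticToContinuum-13603)

**Theorem** (`stub_funnelOfLayered`, pure geometry).  Let `S ⊆ ℝ³` be everywhere `GoodShell`
(`LayeredLawsSelectHcp.Negative.DiracLaws.GoodShell`: at every `x ∈ S`, for some scale `a ∈ [9/10, 1]`, the
recentred set of the other points of `S` in the CLOSED ball of radius `5a/4` about `x` is a finite set
`(a/100)`-matched after a linear isometry to `a • fccKissingPattern` or `a • hcpKissingPattern`) and
`BarlowLike` (bond-isomorphic through a bijection `Φ` with an ideal Barlow stacking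
`barlowStacking 1 √(2/3) s`, bond window `(0, 28/25]`).  Then every point of `S` is `SetGood`
(`PalmGoodLaw.SetGood`: OPEN ball of radius `6/5`, rescaled by `a⁻¹`, tolerance `1/20`, scale in
`[9/10, 11/10]`), and the SAME chart `(s, Φ)` is a bond isomorphism for the window `(0, 6/5)`.

**Proof.**
* Shell facts at a `GoodShell` point `x` (scale `a`, shell `T`, isometry `A`, matching `e`): every shell
  vector has norm within `a/100` of `a` (`abs_norm_sub_le_of_matched`), `T` has twelve elements, and — by
  the `45°` covering angle of both patterns (`fcc_coveringAngle`, `hcp_coveringAngle`) — for every vector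
  `u` some shell vector `t` has `√2·a‖u‖ ≤ 2⟪u, t⟫ + a‖u‖/50` (`exists_inner_ge_of_matched`).
* HOLE LEMMA (`dist_le_of_goodShell`): no point `z ∈ S` has `5a/4 < dist z x < 6/5`.  Otherwise
  `a < 24/25`, and the shell atom `y` of `x` best aligned with `z − x` satisfies
  `dist(z, y)² ≤ d² + (101a/100)² − (√2 − 1/50)·a·d < (891/1000)²` on `9/10 ≤ a`, `5a/4 < d < 6/5`
  (`hole_numerics`); but `GoodShell` at `z` (scale `a_z ≥ 9/10`) pins every other point of `S` within
  `5a_z/4 ≥ 9/8` of `z` at distance `≥ 99a_z/100 ≥ 891/1000` — contradiction (`y ≠ z` since `y` is in the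
  closed `5a/4`-ball about `x` and `z` is not).
* `SetGood` (`setGood_of_goodShell`): by the hole lemma and radial pinning (`101a/100 < 6/5`) the punctured
  open `6/5`-ball and the punctured closed `5a/4`-ball about `y` contain the same points of `S`; rescale the
  shell by `a⁻¹` and match it to `A(pattern)` by nearest atoms (`GoodOfSmallStarDefect.etaMatched_of_near`
  of the same line: equal cardinalities, pattern points `≥ 1 > 2/20` apart, each `A p = a⁻¹ • A (a • p)`
  within `a⁻¹ · a/100 ≤ 1/20` of a rescaled atom).
* Chart (`chart_window`): a lattice bond maps into `(0, 28/25] ⊂ (0, 6/5)`; conversely if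
  `0 < dist (Φ p) (Φ q) < 6/5` then by the hole lemma `Φ q − Φ p` lies in the twelve-element shell `T` of
  `Φ p`, which is filled by the images of the twelve lattice neighbours of `p`
  (`ncard_touching_eq_twelve`, `Φ` injective on the stacking, `Set.eq_of_subset_of_ncard_le`), so `q` is
  one of them.  All `[folklore]`.
-/

noncomputable section

namespace Summit.AtomisticToContinuum.Crystallization.Theorems.PalmGoodLaw.FunnelOfLayered

open Literature.MathematicalPhysics.StatisticalMechanics Literature.Geometry.DiscreteGeometry
open Summit.AtomisticToContinuum.Crystallization.Theorems.LayeredLawsSelectHcp.Negative.DiracLaws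
  (GoodShell BarlowLike)
open Summit.AtomisticToContinuum.Crystallization.Theorems.PalmUnimodularRigidityShellsToBarlowChart
  (fcc_coveringAngle hcp_coveringAngle)
open Summit.AtomisticToContinuum.Crystallization.Theorems.PalmGoodLaw.GoodOfSmallStarDefect
  (etaMatched_of_near)

/-! ## Numerical facts -/

/-- `1.4142 < √2`. [folklore] -/
theorem lt_sqrt_two : (14142 / 10000 : ℝ) < Real.sqrt 2 := by
  rw [show (14142 / 10000 : ℝ) = Real.sqrt ((14142 / 10000) ^ 2) by rw [Real.sqrt_sq]; norm_num]
  exact Real.sqrt_lt_sqrt (by norm_num) (by norm_num)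

/-- **The numerical heart of the hole lemma.**  With `n = ‖y − x‖ ≤ 101a/100`, `i = ⟪z − x, y − x⟫`,
`r = √2 > 1.4142` and the directional bound `r·a·d ≤ 2i + a·d/50`, the squared distance
`d² − 2i + n²` is `< (891/1000)²` throughout `9/10 ≤ a`, `5a/4 < d < 6/5`. [folklore] -/
theorem hole_numerics {a d n i r : ℝ} (ha9 : 9 / 10 ≤ a) (hlt : 5 / 4 * a < d) (hd : d < 6 / 5)
    (hn0 : 0 ≤ n) (hn : n ≤ 101 / 100 * a) (hr : 14142 / 10000 < r)
    (hi : r * (a * d) ≤ 2 * i + a * d / 50) :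
    d ^ 2 - 2 * i + n ^ 2 < (891 / 1000) ^ 2 := by
  have ha0 : 0 ≤ a := by linarith
  have hd0 : 0 ≤ d := by linarith
  have h24 : a < 24 / 25 := by linarith
  have h1 : n ^ 2 ≤ (101 / 100 * a) ^ 2 := pow_le_pow_left₀ hn0 hn 2
  have h2 : 14142 / 10000 * (a * d) ≤ r * (a * d) :=
    mul_le_mul_of_nonneg_right hr.le (mul_nonneg ha0 hd0)
  nlinarith [mul_pos (sub_pos.2 hlt) (sub_pos.2 hd), mul_nonneg (sub_nonneg.2 ha9) (sub_pos.2 hlt).le,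
    mul_nonneg (sub_nonneg.2 ha9) (sub_pos.2 h24).le]

/-! ## Pattern facts, uniform in the pattern -/

/-- The two kissing patterns have twelve unit vectors, pairwise `≥ 1` apart, with covering angle `45°`.
[folklore] -/
theorem pattern_facts {P : Finset (EuclideanSpace ℝ (Fin 3))}
    (hP : P = fccKissingPattern ∨ P = hcpKissingPattern) :
    P.card = 12 ∧ (∀ v ∈ P, ‖v‖ = 1) ∧ (∀ v ∈ P, ∀ w ∈ P, v ≠ w → 1 ≤ dist v w) ∧
      ∀ u : EuclideanSpace ℝ (Fin 3), ∃ v ∈ P, ‖u‖ ≤ Real.sqrt 2 * inner ℝ u v := by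
  rcases hP with rfl | rfl
  · exact ⟨card_fccKissingPattern, fun v hv => norm_eq_one_of_mem_fccKissingPattern hv,
      fun v hv w hw hvw => one_le_dist_of_mem_fccKissingPattern hv hw hvw, fcc_coveringAngle⟩
  · exact ⟨card_hcpKissingPattern, fun v hv => norm_eq_one_of_mem_hcpKissingPattern hv,
      fun v hv w hw hvw => one_le_dist_of_mem_hcpKissingPattern hv hw hvw, hcp_coveringAngle⟩

/-! ## Shell facts at a `GoodShell` point -/

/-- `GoodShell` data, uniform in the pattern. [folklore] -/
theorem goodShell_data {S : Set (EuclideanSpace ℝ (Fin 3))} {x : EuclideanSpace ℝ (Fin 3)}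
    (h : GoodShell S x) :
    ∃ a : ℝ, 9 / 10 ≤ a ∧ a ≤ 1 ∧ ∃ T : Finset (EuclideanSpace ℝ (Fin 3)),
      (↑T : Set (EuclideanSpace ℝ (Fin 3))) = (fun y : EuclideanSpace ℝ (Fin 3) => y - x) ''
        {y : EuclideanSpace ℝ (Fin 3) | y ∈ S ∧ y ≠ x ∧ dist y x ≤ 5 / 4 * a} ∧
      ∃ P : Finset (EuclideanSpace ℝ (Fin 3)), (P = fccKissingPattern ∨ P = hcpKissingPattern) ∧
        ∃ A : EuclideanSpace ℝ (Fin 3) →ₗᵢ[ℝ] EuclideanSpace ℝ (Fin 3),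
          ∃ e : ↥T ≃ ↥((P.image fun v : EuclideanSpace ℝ (Fin 3) => a • v).image A),
            ∀ t : ↥T, dist (t : EuclideanSpace ℝ (Fin 3)) (e t) ≤ a / 100 := by
  obtain ⟨a, ha9, ha1, T, hT, hclose⟩ := h
  rcases hclose with ⟨A, e, he⟩ | ⟨A, e, he⟩
  · exact ⟨a, ha9, ha1, T, hT, fccKissingPattern, Or.inl rfl, A, e, he⟩
  · exact ⟨a, ha9, ha1, T, hT, hcpKissingPattern, Or.inr rfl, A, e, he⟩

/-- **Radial pinning of a matched shell**: every shell vector has norm within `a/100` of `a` (pattern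
points are unit vectors, the isometry preserves norms). [folklore] -/
theorem abs_norm_sub_le_of_matched {a : ℝ} (ha : 0 ≤ a) {T P : Finset (EuclideanSpace ℝ (Fin 3))}
    (hP1 : ∀ v ∈ P, ‖v‖ = 1) {A : EuclideanSpace ℝ (Fin 3) →ₗᵢ[ℝ] EuclideanSpace ℝ (Fin 3)}
    (e : ↥T ≃ ↥((P.image fun v : EuclideanSpace ℝ (Fin 3) => a • v).image A))
    (he : ∀ t : ↥T, dist (t : EuclideanSpace ℝ (Fin 3)) (e t) ≤ a / 100)
    {t : EuclideanSpace ℝ (Fin 3)} (ht : t ∈ T) : |‖t‖ - a| ≤ a / 100 := by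
  obtain ⟨q, hq, hqe⟩ := Finset.mem_image.1 (e ⟨t, ht⟩).2
  obtain ⟨p, hp, rfl⟩ := Finset.mem_image.1 hq
  have hn : ‖((e ⟨t, ht⟩ : ↥((P.image fun v : EuclideanSpace ℝ (Fin 3) => a • v).image A)) :
      EuclideanSpace ℝ (Fin 3))‖ = a := by
    rw [← hqe, A.norm_map, norm_smul, Real.norm_of_nonneg ha, hP1 p hp, mul_one]
  calc |‖t‖ - a| = |‖t‖ - ‖((e ⟨t, ht⟩ : ↥((P.image fun v : EuclideanSpace ℝ (Fin 3) => a • v).image A)) :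
        EuclideanSpace ℝ (Fin 3))‖| := by rw [hn]
    _ ≤ ‖t - (e ⟨t, ht⟩ : EuclideanSpace ℝ (Fin 3))‖ := abs_norm_sub_norm_le _ _
    _ ≤ a / 100 := by rw [← dist_eq_norm]; exact he ⟨t, ht⟩

/-- **Directional shell fact** (the `45°` covering angle up to the `a/100` matching error): for every
vector `u` some shell vector `t` has `‖t‖ ≤ 101a/100` and `√2·a‖u‖ ≤ 2⟪u, t⟫ + a‖u‖/50`. [folklore] -/
theorem exists_inner_ge_of_matched {a : ℝ} (ha : 0 ≤ a) {T P : Finset (EuclideanSpace ℝ (Fin 3))}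
    (hP1 : ∀ v ∈ P, ‖v‖ = 1)
    (hcov : ∀ u : EuclideanSpace ℝ (Fin 3), ∃ v ∈ P, ‖u‖ ≤ Real.sqrt 2 * inner ℝ u v)
    {A : EuclideanSpace ℝ (Fin 3) →ₗᵢ[ℝ] EuclideanSpace ℝ (Fin 3)}
    (e : ↥T ≃ ↥((P.image fun v : EuclideanSpace ℝ (Fin 3) => a • v).image A))
    (he : ∀ t : ↥T, dist (t : EuclideanSpace ℝ (Fin 3)) (e t) ≤ a / 100)
    (u : EuclideanSpace ℝ (Fin 3)) :
    ∃ t ∈ T, ‖t‖ ≤ 101 / 100 * a ∧ Real.sqrt 2 * (a * ‖u‖) ≤ 2 * inner ℝ u t + a * ‖u‖ / 50 := by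
  -- a preimage direction `u'` with `A u' = u`
  obtain ⟨u', hu'⟩ : ∃ u' : EuclideanSpace ℝ (Fin 3), A u' = u :=
    ⟨(A.toLinearIsometryEquiv rfl).symm u, by
      rw [← LinearIsometry.coe_toLinearIsometryEquiv A rfl]
      exact (A.toLinearIsometryEquiv rfl).apply_symm_apply u⟩
  have hnu : ‖u'‖ = ‖u‖ := by rw [← hu', LinearIsometry.norm_map]
  obtain ⟨v, hv, hcv⟩ := hcov u'
  have hq : A (a • v) ∈ (P.image fun v : EuclideanSpace ℝ (Fin 3) => a • v).image A :=
    Finset.mem_image_of_mem _ (Finset.mem_image_of_mem _ hv)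
  obtain ⟨t, ht⟩ : ∃ t : ↥T, e t = ⟨A (a • v), hq⟩ := ⟨e.symm _, e.apply_symm_apply _⟩
  have het : (e t : EuclideanSpace ℝ (Fin 3)) = A (a • v) := by rw [ht]
  have hdist : ‖(t : EuclideanSpace ℝ (Fin 3)) - A (a • v)‖ ≤ a / 100 := by
    rw [← het, ← dist_eq_norm]; exact he t
  have hAv : ‖A (a • v)‖ = a := by
    rw [A.norm_map, norm_smul, Real.norm_of_nonneg ha, hP1 v hv, mul_one]
  refine ⟨t, t.2, ?_, ?_⟩
  · have htri := norm_le_norm_add_norm_sub' (t : EuclideanSpace ℝ (Fin 3)) (A (a • v))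
    linarith
  · have hinner : inner ℝ u (A (a • v)) = a * inner ℝ u' v := by
      rw [← hu', LinearIsometry.inner_map_map, real_inner_smul_right]
    have hsplit : inner ℝ u (t : EuclideanSpace ℝ (Fin 3)) =
        inner ℝ u (A (a • v)) + inner ℝ u ((t : EuclideanSpace ℝ (Fin 3)) - A (a • v)) := by
      rw [← inner_add_right, add_sub_cancel]
    have herr : |inner ℝ u ((t : EuclideanSpace ℝ (Fin 3)) - A (a • v))| ≤ ‖u‖ * (a / 100) :=
      (abs_real_inner_le_norm _ _).trans (mul_le_mul_of_nonneg_left hdist (norm_nonneg _))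
    rw [abs_le] at herr
    have hs2 : 0 ≤ Real.sqrt 2 := Real.sqrt_nonneg _
    -- `a‖u‖ ≤ a √2 ⟪u', v⟫`, then multiply by `√2`
    have h1 : a * ‖u‖ ≤ a * (Real.sqrt 2 * inner ℝ u' v) :=
      mul_le_mul_of_nonneg_left (hnu ▸ hcv) ha
    have h2 : Real.sqrt 2 * (a * ‖u‖) ≤ Real.sqrt 2 * (a * (Real.sqrt 2 * inner ℝ u' v)) :=
      mul_le_mul_of_nonneg_left h1 hs2
    have h3 : Real.sqrt 2 * (a * (Real.sqrt 2 * inner ℝ u' v)) = 2 * (a * inner ℝ u' v) := by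
      have : Real.sqrt 2 * (a * (Real.sqrt 2 * inner ℝ u' v)) =
          Real.sqrt 2 * Real.sqrt 2 * (a * inner ℝ u' v) := by ring
      rw [this, Real.mul_self_sqrt zero_le_two]
    rw [h3] at h2
    rw [hsplit, hinner]
    nlinarith [herr.1]

/-! ## The hole lemma -/

/-- **Hole lemma.**  In an everywhere-`GoodShell` set, at a point `x` with shell data of scale `a`, every
point of `S` in the open ball of radius `6/5` about `x` already lies in the closed ball of radius `5a/4`:
a point `z` with `5a/4 < dist z x < 6/5` would be at distance `< 891/1000` from the shell atom of `x`
best aligned with `z − x`, contradicting the radial pinning `≥ 99a_z/100 ≥ 891/1000` of the shell of `z`.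
[folklore] -/
theorem dist_le_of_goodShell {S : Set (EuclideanSpace ℝ (Fin 3))} (hG : ∀ x ∈ S, GoodShell S x)
    {x : EuclideanSpace ℝ (Fin 3)} {a : ℝ} (ha9 : 9 / 10 ≤ a)
    {T P : Finset (EuclideanSpace ℝ (Fin 3))}
    (hT : (↑T : Set (EuclideanSpace ℝ (Fin 3))) = (fun y : EuclideanSpace ℝ (Fin 3) => y - x) ''
      {y : EuclideanSpace ℝ (Fin 3) | y ∈ S ∧ y ≠ x ∧ dist y x ≤ 5 / 4 * a})
    (hP : P = fccKissingPattern ∨ P = hcpKissingPattern)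
    {A : EuclideanSpace ℝ (Fin 3) →ₗᵢ[ℝ] EuclideanSpace ℝ (Fin 3)}
    (e : ↥T ≃ ↥((P.image fun v : EuclideanSpace ℝ (Fin 3) => a • v).image A))
    (he : ∀ t : ↥T, dist (t : EuclideanSpace ℝ (Fin 3)) (e t) ≤ a / 100)
    {z : EuclideanSpace ℝ (Fin 3)} (hz : z ∈ S) (hd : dist z x < 6 / 5) : dist z x ≤ 5 / 4 * a := by
  by_contra hlt
  push Not at hlt
  obtain ⟨-, hP1, -, hcov⟩ := pattern_facts hP
  have ha0 : 0 ≤ a := by linarith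
  obtain ⟨t, htT, htn, hti⟩ := exists_inner_ge_of_matched ha0 hP1 hcov e he (z - x)
  -- `t = y - x` for an atom `y` of the closed `5a/4`-ball about `x`
  have ht' : t ∈ (↑T : Set (EuclideanSpace ℝ (Fin 3))) := htT
  rw [hT] at ht'
  obtain ⟨y, ⟨hyS, -, hyd⟩, rfl⟩ := ht'
  -- `dist z y < 891/1000`
  have hzy : dist z y ^ 2 = ‖z - x‖ ^ 2 - 2 * inner ℝ (z - x) (y - x) + ‖y - x‖ ^ 2 := by
    rw [dist_eq_norm, ← norm_sub_sq_real, sub_sub_sub_cancel_right]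
  have hdzx : ‖z - x‖ = dist z x := (dist_eq_norm z x).symm
  rw [hdzx] at hzy hti
  have hzy2 : dist z y ^ 2 < (891 / 1000) ^ 2 := by
    rw [hzy]
    exact hole_numerics ha9 hlt hd (norm_nonneg _) htn lt_sqrt_two hti
  have hzy1 : dist z y < 891 / 1000 := by
    nlinarith [dist_nonneg (x := z) (y := y)]
  -- `GoodShell` at `z` pins `y` at distance `≥ 99 a_z / 100`
  obtain ⟨az, haz9, -, Tz, hTz, Pz, hPz, Az, ez, hez⟩ := goodShell_data (hG z hz)
  have hyz : y ≠ z := by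
    rintro rfl
    linarith
  rw [dist_comm] at hzy1
  have hmem : y - z ∈ (↑Tz : Set (EuclideanSpace ℝ (Fin 3))) := by
    rw [hTz]
    exact ⟨y, ⟨hyS, hyz, by linarith⟩, rfl⟩
  obtain ⟨-, hPz1, -, -⟩ := pattern_facts hPz
  have hrad := abs_norm_sub_le_of_matched (by linarith) hPz1 ez hez hmem
  rw [← dist_eq_norm, abs_le] at hrad
  linarith [hrad.1]

/-! ## Every point is `SetGood` -/

/-- The number of shell points equals the number of pattern points. [folklore] -/
theorem card_eq_of_matched {a : ℝ} (ha : a ≠ 0) {T P : Finset (EuclideanSpace ℝ (Fin 3))}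
    {A : EuclideanSpace ℝ (Fin 3) →ₗᵢ[ℝ] EuclideanSpace ℝ (Fin 3)}
    (e : ↥T ≃ ↥((P.image fun v : EuclideanSpace ℝ (Fin 3) => a • v).image A)) :
    T.card = P.card := by
  have h := Fintype.card_congr e
  simp only [Fintype.card_coe] at h
  rw [h, Finset.card_image_of_injective _ A.injective,
    Finset.card_image_of_injective _ (smul_right_injective _ ha)]

/-- **Every point of an everywhere-`GoodShell` set is `SetGood`**, at the same scale and with the same
isometry: the two punctured neighbourhoods agree (hole lemma and radial pinning), and the rescaled shell
is `1/100 ≤ 1/20`-matched to the rotated pattern by nearest atoms. [folklore] -/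
theorem setGood_of_goodShell {S : Set (EuclideanSpace ℝ (Fin 3))} (hG : ∀ x ∈ S, GoodShell S x)
    {y : EuclideanSpace ℝ (Fin 3)} (hy : y ∈ S) : SetGood S y := by
  obtain ⟨a, ha9, ha1, T, hT, P, hP, A, e, he⟩ := goodShell_data (hG y hy)
  obtain ⟨-, hP1, hPsep, hcov⟩ := pattern_facts hP
  have ha0 : 0 < a := by linarith
  -- the punctured open `6/5`-ball and the punctured closed `5a/4`-ball about `y` agree on `S`
  have hsets : {z : EuclideanSpace ℝ (Fin 3) | z ∈ S ∧ z ≠ y ∧ dist z y < 6 / 5} =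
      {z : EuclideanSpace ℝ (Fin 3) | z ∈ S ∧ z ≠ y ∧ dist z y ≤ 5 / 4 * a} := by
    ext z
    simp only [Set.mem_setOf_eq]
    constructor
    · rintro ⟨hz, hne, hd⟩
      exact ⟨hz, hne, dist_le_of_goodShell hG ha9 hT hP e he hz hd⟩
    · rintro ⟨hz, hne, hd⟩
      refine ⟨hz, hne, ?_⟩
      have hmem : z - y ∈ (↑T : Set (EuclideanSpace ℝ (Fin 3))) := by
        rw [hT]; exact ⟨z, ⟨hz, hne, hd⟩, rfl⟩
      have hrad := abs_norm_sub_le_of_matched ha0.le hP1 e he hmem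
      rw [← dist_eq_norm, abs_le] at hrad
      linarith [hrad.2]
  refine ⟨a, ha9, by linarith, T.image (fun t : EuclideanSpace ℝ (Fin 3) => a⁻¹ • t), ?_, ?_⟩
  · rw [Finset.coe_image, hT, Set.image_image, hsets]
  · have hmatch : EtaMatched (1 / 20) (T.image fun t : EuclideanSpace ℝ (Fin 3) => a⁻¹ • t)
        (P.image A) := by
      refine etaMatched_of_near ?_ ?_ ?_
      · rw [Finset.card_image_of_injective _ (smul_right_injective _ (inv_ne_zero ha0.ne')),
          Finset.card_image_of_injective _ A.injective, card_eq_of_matched ha0.ne' e]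
      · intro p hp q hq hpq
        obtain ⟨p', hp', rfl⟩ := Finset.mem_image.1 hp
        obtain ⟨q', hq', rfl⟩ := Finset.mem_image.1 hq
        have hne : p' ≠ q' := fun h => hpq (by rw [h])
        have h1 := hPsep p' hp' q' hq' hne
        rw [A.dist_map]
        linarith
      · intro q hq
        obtain ⟨p, hp, rfl⟩ := Finset.mem_image.1 hq
        have hq' : A (a • p) ∈ (P.image fun v : EuclideanSpace ℝ (Fin 3) => a • v).image A :=
          Finset.mem_image_of_mem _ (Finset.mem_image_of_mem _ hp)
        obtain ⟨t, ht⟩ : ∃ t : ↥T, e t = ⟨A (a • p), hq'⟩ := ⟨e.symm _, e.apply_symm_apply _⟩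
        have het : (e t : EuclideanSpace ℝ (Fin 3)) = A (a • p) := by rw [ht]
        refine ⟨a⁻¹ • (t : EuclideanSpace ℝ (Fin 3)), Finset.mem_image_of_mem _ t.2, ?_⟩
        have h1 : dist (t : EuclideanSpace ℝ (Fin 3)) (A (a • p)) ≤ a / 100 := by
          rw [← het]; exact he t
        have h2 : A p = a⁻¹ • A (a • p) := by
          rw [A.map_smul, smul_smul, inv_mul_cancel₀ ha0.ne', one_smul]
        rw [h2, dist_smul₀, norm_inv, Real.norm_of_nonneg ha0.le]
        calc a⁻¹ * dist (t : EuclideanSpace ℝ (Fin 3)) (A (a • p)) ≤ a⁻¹ * (a / 100) :=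
              mul_le_mul_of_nonneg_left h1 (inv_nonneg.2 ha0.le)
          _ = 1 / 100 := by field_simp
          _ ≤ 1 / 20 := by norm_num
    rcases hP with rfl | rfl
    · exact Or.inl ⟨A, hmatch⟩
    · exact Or.inr ⟨A, hmatch⟩

/-! ## The chart with bond window `(0, 6/5)` -/

/-- **The `BarlowLike` chart is a bond isomorphism for the window `(0, 6/5)`**: a lattice bond maps into
`(0, 28/25] ⊂ (0, 6/5)`; conversely a pair at distance in `(0, 6/5)` is, by the hole lemma, a pair at
distance `≤ 5a/4`, hence a shell vector of the twelve-element shell of `Φ p`, which is filled by the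
images of the twelve lattice neighbours of `p`. [folklore] -/
theorem chart_window {S : Set (EuclideanSpace ℝ (Fin 3))} (hG : ∀ x ∈ S, GoodShell S x) {s : ℤ → ℤ}
    (hs : IsHaggSeq s) {Φ : EuclideanSpace ℝ (Fin 3) → EuclideanSpace ℝ (Fin 3)}
    (hΦ : Set.BijOn Φ (barlowStacking 1 (Real.sqrt (2 / 3)) s) S)
    (hb : ∀ p ∈ barlowStacking 1 (Real.sqrt (2 / 3)) s, ∀ q ∈ barlowStacking 1 (Real.sqrt (2 / 3)) s,
      (dist p q = 1 ↔ (0 < dist (Φ p) (Φ q) ∧ dist (Φ p) (Φ q) ≤ 28 / 25)))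
    {p q : EuclideanSpace ℝ (Fin 3)} (hp : p ∈ barlowStacking 1 (Real.sqrt (2 / 3)) s)
    (hq : q ∈ barlowStacking 1 (Real.sqrt (2 / 3)) s) :
    dist p q = 1 ↔ (0 < dist (Φ p) (Φ q) ∧ dist (Φ p) (Φ q) < 6 / 5) := by
  constructor
  · intro h1
    obtain ⟨h0, h28⟩ := (hb p hp q hq).1 h1
    exact ⟨h0, by linarith⟩
  · rintro ⟨h0, h65⟩
    have hx : Φ p ∈ S := hΦ.mapsTo hp
    have hz : Φ q ∈ S := hΦ.mapsTo hq
    obtain ⟨a, ha9, -, T, hT, P, hP, A, e, he⟩ := goodShell_data (hG _ hx)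
    obtain ⟨hPc, -, -, -⟩ := pattern_facts hP
    have ha0 : 0 < a := by linarith
    have hTcard : T.card = 12 := by rw [card_eq_of_matched ha0.ne' e, hPc]
    -- hole lemma: `Φ q` is in the closed `5a/4`-ball about `Φ p`
    have hzq : dist (Φ q) (Φ p) ≤ 5 / 4 * a :=
      dist_le_of_goodShell hG ha9 hT hP e he hz (by rwa [dist_comm])
    have hne : Φ q ≠ Φ p := fun h => by rw [h, dist_self] at h0; exact lt_irrefl _ h0
    have hmemq : Φ q - Φ p ∈ (↑T : Set (EuclideanSpace ℝ (Fin 3))) := by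
      rw [hT]; exact ⟨Φ q, ⟨hz, hne, hzq⟩, rfl⟩
    -- the twelve lattice neighbours of `p` fill `T`
    set N : Set (EuclideanSpace ℝ (Fin 3)) :=
      {w | w ∈ barlowStacking 1 (Real.sqrt (2 / 3)) s ∧ dist p w = 1} with hN_def
    have hN12 : N.ncard = 12 :=
      ncard_touching_eq_twelve hs one_pos (by rw [Real.sq_sqrt (by norm_num)]; norm_num) hp
    have hNsub : (fun w => Φ w - Φ p) '' N ⊆ ↑T := by
      rintro _ ⟨w, ⟨hwL, hw1⟩, rfl⟩
      rw [hT]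
      obtain ⟨hw0, hw28⟩ := (hb p hp w hwL).1 hw1
      refine ⟨Φ w, ⟨hΦ.mapsTo hwL, fun h => ?_, ?_⟩, rfl⟩
      · rw [h, dist_self] at hw0; exact lt_irrefl _ hw0
      · rw [dist_comm]; linarith
    have hinj : Set.InjOn (fun w => Φ w - Φ p) N := by
      intro w hw w' hw' h
      exact hΦ.injOn hw.1 hw'.1 (sub_left_injective h)
    have hNcard : ((fun w => Φ w - Φ p) '' N).ncard = 12 := by rw [hinj.ncard_image, hN12]
    have heq : (fun w => Φ w - Φ p) '' N = ↑T :=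
      Set.eq_of_subset_of_ncard_le hNsub (by rw [Set.ncard_coe_finset, hTcard, hNcard])
        T.finite_toSet
    rw [← heq] at hmemq
    obtain ⟨w, ⟨hwL, hw1⟩, hweq⟩ := hmemq
    have hwq : w = q := hΦ.injOn hwL hq (sub_left_injective hweq)
    rw [← hwq]; exact hw1

/-! ## The registered stub -/

/-- **Stub `stub_funnelOfLayered` of line `palm-good-law` (class inclusion: the `1 %`-tube class of crux
9226 sits inside the `1/20`-funnel class).**  An everywhere-`GoodShell`, `BarlowLike` set is everywhere
`SetGood`, and its Barlow chart is a bond isomorphism for the window `(0, 6/5)`. [folklore] -/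
theorem stub_funnelOfLayered :
    ∀ S : Set (EuclideanSpace ℝ (Fin 3)), (∀ x ∈ S, Summit.AtomisticToContinuum.Crystallization.Theorems.LayeredLawsSelectHcp.Negative.DiracLaws.GoodShell S x) → Summit.AtomisticToContinuum.Crystallization.Theorems.LayeredLawsSelectHcp.Negative.DiracLaws.BarlowLike S → (∀ y ∈ S, Summit.AtomisticToContinuum.Crystallization.Theorems.PalmGoodLaw.SetGood S y) ∧ ∃ s : ℤ → ℤ, IsHaggSeq s ∧ ∃ Φ : EuclideanSpace ℝ (Fin 3) → EuclideanSpace ℝ (Fin 3), Set.BijOn Φ (barlowStacking 1 (Real.sqrt (2 / 3)) s) S ∧ ∀ p ∈ barlowStacking 1 (Real.sqrt (2 / 3)) s, ∀ q ∈ barlowStacking 1 (Real.sqrt (2 / 3)) s, (dist p q = 1 ↔ (0 < dist (Φ p) (Φ q) ∧ dist (Φ p) (Φ q) < 6 / 5)) := by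
  intro S hG hB
  refine ⟨fun y hy => setGood_of_goodShell hG hy, ?_⟩
  obtain ⟨s, hs, Φ, hΦ, hb⟩ := hB
  exact ⟨s, hs, Φ, hΦ, fun p hp q hq => chart_window hG hs hΦ hb hp hq⟩

end Summit.AtomisticToContinuum.Crystallization.Theorems.PalmGoodLaw.FunnelOfLayered

end
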